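import Summits.RiemannHypothesis.RiemannHypothesis.Theorems.AsymptoticCriticalLine.Negative.Ladder
import Summits.RiemannHypothesis.RiemannHypothesis.Theorems.AsymptoticCriticalLine.Negative.Products
import Literature.NumberTheory.LFunctions.FiniteEulerProducts

/-!
# Vertically periodic models: the band ladder collapses (negative lemmas for `AsymptoticCriticalLine`)

Refuter work file (cdisprove, cycle 4) supporting crux stmt-RiemannHypothesis-2063
(`RuelleBand.AsymptoticCriticalLine`, rung #4: for every `ε > 0` only finitely many zeros of `ζ`
in the open strip have `|Re s − 1/2| ≥ ε`).

If the strip zero set of `Z` is invariant under a vertical translation `s ↦ s + iτ`, `τ ≠ 0` —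
the shape of every function of `q^{-s}` (zeta functions `Z(X, q^{-s})` of curves and varieties
over `𝔽_q`, Dirichlet polynomials in the powers of one prime), of a single Euler factor
`1 − α p^{−s}`, and, factor by factor, of every FINITE Euler product — then ONE off-line zero
generates a whole band at its own level (`band_iff_offLineSet_eq_empty`): rung #4 holds iff rung #5
holds iff there is NO off-line zero in the open strip at all (`offLineSet_finite_iff_eq_empty`).
For a single Euler factor the zeros fill the line `Re s = log ‖α‖ / log p`
(`re_eq_of_eulerTerm_eq_zero`), so the band shape holds iff that line misses the open strip or is
the critical line (`not_band_eulerTerm`, `band_eulerTerm_of_norm_eq_sqrt`); for a finite Euler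
product `∏ᵢ (1 − αᵢ pᵢ^{−s})` the shape holds iff no factor has an off-line zero
(`band_finiteEuler_iff`), and the local factors of `ζ` itself (`αᵢ = 1`, zeros on `Re s = 0`)
give EMPTY bands for every finite set of primes (`bandSet_zetaLocalFactors_eq_empty`), as does
the `S`-local zeta function `ζ_S = π^{−s/2} Γ(s/2) ∏_{p∈S} (1 − p^{−s})⁻¹` itself, zero-free on `Re s > 0`
(`localZeta_ne_zero`, `bandSet_localZeta_eq_empty`).

Reading for the route (RuelleBand, TWO-LAYER PLAN "S-local band realisation, S finite ∋ ∞ →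
Lasota–Yorke constants uniform in S → global"; NOT DECOMPOSED YET "no function-field sanity
rung"): the slack of rung #4 below RH — infinitely many off-line zeros with `Re ρ → 1/2` are
allowed (`not_forall_powerSum_imp_finite`) — exists only for an APERIODIC zero set, i.e. for the
infinite product with its archimedean height dependence. It is invisible prime by prime (the
S-local layer has empty zero content: everything sits in the uniformity as `S → ∞`) and over
`𝔽_q` (where any proof of the band shape is a proof of the full RH-shape, Weil's theorem): neither
sanity check can distinguish a band-strength mechanism from an RH-strength one.

All statements `sorry`-free; axioms `propext`, `Classical.choice`, `Quot.sound`.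
-/

noncomputable section

set_option linter.dupNamespace false

namespace Summit.RiemannHypothesis.RiemannHypothesis.Theorems.AsymptoticCriticalLine.Negative

open Complex Set
open Literature.NumberTheory.LFunctions (eulerTerm eulerTerm_eq_zero_iff eulerTermZero
  eulerTerm_eulerTermZero norm_eq_rpow_of_eulerTerm_eq_zero natCast_cpow_neg_eq_exp
  ne_zero_of_eulerTerm_eq_zero)

/-! ## Vertical periodicity of a zero set -/

/-- The zero set of `Z` is invariant under the vertical translation `s ↦ s + iτ`. [folklore] -/
def VertPeriodic (Z : ℂ → ℂ) (τ : ℝ) : Prop :=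
  ∀ s : ℂ, Z s = 0 → Z (s + τ * I) = 0

/-- Iterating the period. [folklore] -/
theorem VertPeriodic.iterate {Z : ℂ → ℂ} {τ : ℝ} (h : VertPeriodic Z τ) {s : ℂ} (hs : Z s = 0)
    (n : ℕ) : Z (s + n * τ * I) = 0 := by
  induction n with
  | zero => simpa using hs
  | succ n ih =>
    have := h _ ih
    convert this using 2
    push_cast
    ring

/-- The translates `s + inτ`, `n ∈ ℕ`. [folklore] -/
def vertTranslate (s : ℂ) (τ : ℝ) (n : ℕ) : ℂ :=
  s + n * τ * I

/-- [folklore] -/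
theorem vertTranslate_re (s : ℂ) (τ : ℝ) (n : ℕ) : (vertTranslate s τ n).re = s.re := by
  simp [vertTranslate]

/-- [folklore] -/
theorem vertTranslate_im (s : ℂ) (τ : ℝ) (n : ℕ) : (vertTranslate s τ n).im = s.im + n * τ := by
  simp [vertTranslate]

/-- [folklore] -/
theorem vertTranslate_injective (s : ℂ) {τ : ℝ} (hτ : τ ≠ 0) :
    Function.Injective (vertTranslate s τ) := by
  intro a b hab
  have h := congrArg Complex.im hab
  rw [vertTranslate_im, vertTranslate_im, add_right_inj] at h
  exact_mod_cast mul_right_cancel₀ hτ h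

/-- ONE OFF-LINE ZERO GENERATES A BAND: under vertical periodicity every off-line zero `s` of the
open strip puts the infinite set `{s + inτ}` into the band of level `|Re s − 1/2|`. [folklore] -/
theorem bandSet_infinite_of_mem_offLineSet {Z : ℂ → ℂ} {τ : ℝ} (hτ : τ ≠ 0) (h : VertPeriodic Z τ)
    {s : ℂ} (hs : s ∈ offLineSet Z) : (bandSet Z |s.re - 1 / 2|).Infinite := by
  obtain ⟨hz, h0, h1, _⟩ := hs
  have hsub : Set.range (vertTranslate s τ) ⊆ bandSet Z |s.re - 1 / 2| := by
    rintro _ ⟨n, rfl⟩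
    refine ⟨h.iterate hz n, ?_, ?_, ?_⟩
    · rw [vertTranslate_re]; exact h0
    · rw [vertTranslate_re]; exact h1
    · rw [vertTranslate_re]
  exact (Set.infinite_range_of_injective (vertTranslate_injective s hτ)).mono hsub

/-- LADDER COLLAPSE, rung #4: for a vertically periodic zero set the band shape (every band of
positive level finite) holds iff there is NO off-line zero in the open strip. [folklore] -/
theorem band_iff_offLineSet_eq_empty {Z : ℂ → ℂ} {τ : ℝ} (hτ : τ ≠ 0) (h : VertPeriodic Z τ) :
    (∀ ε : ℝ, 0 < ε → (bandSet Z ε).Finite) ↔ offLineSet Z = ∅ := by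
  constructor
  · intro hb
    by_contra hne
    obtain ⟨s, hs⟩ := Set.nonempty_iff_ne_empty.2 hne
    have hε : 0 < |s.re - 1 / 2| := abs_pos.2 (sub_ne_zero.2 hs.2.2.2)
    exact bandSet_infinite_of_mem_offLineSet hτ h hs (hb _ hε)
  · intro he ε hε
    have : bandSet Z ε = ∅ := Set.eq_empty_of_subset_empty (he ▸ bandSet_subset_offLineSet Z hε)
    rw [this]
    exact Set.finite_empty

/-- LADDER COLLAPSE, rung #5: for a vertically periodic zero set the off-line zero set is finite
iff it is empty. So #4 ⟺ #5 ⟺ "exact" on periodic models. [folklore] -/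
theorem offLineSet_finite_iff_eq_empty {Z : ℂ → ℂ} {τ : ℝ} (hτ : τ ≠ 0) (h : VertPeriodic Z τ) :
    (offLineSet Z).Finite ↔ offLineSet Z = ∅ := by
  refine ⟨fun hf => ?_, fun he => he ▸ Set.finite_empty⟩
  by_contra hne
  obtain ⟨s, hs⟩ := Set.nonempty_iff_ne_empty.2 hne
  have hε : 0 < |s.re - 1 / 2| := abs_pos.2 (sub_ne_zero.2 hs.2.2.2)
  exact bandSet_infinite_of_mem_offLineSet hτ h hs (hf.subset (bandSet_subset_offLineSet Z hε))

/-- On periodic models the two rungs coincide. [folklore] -/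
theorem band_iff_offLineSet_finite {Z : ℂ → ℂ} {τ : ℝ} (hτ : τ ≠ 0) (h : VertPeriodic Z τ) :
    (∀ ε : ℝ, 0 < ε → (bandSet Z ε).Finite) ↔ (offLineSet Z).Finite := by
  rw [band_iff_offLineSet_eq_empty hτ h, offLineSet_finite_iff_eq_empty hτ h]

/-! ## Functions of `q^{-s}` (the function-field shape) -/

/-- `q^{-iτ} = 1` for the period `τ = 2π / log q` (`q > 1` a natural number). [folklore] -/
theorem natCast_cpow_neg_period {q : ℕ} (hq : 1 < q) :
    (q : ℂ) ^ (-(((2 * Real.pi / Real.log q : ℝ) : ℂ) * I)) = 1 := by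
  have hq0 : (q : ℂ) ≠ 0 := by exact_mod_cast (by omega : q ≠ 0)
  have hlog : Real.log q ≠ 0 :=
    Real.log_ne_zero_of_pos_of_ne_one (by exact_mod_cast (by omega : 0 < q)) (by exact_mod_cast hq.ne')
  have h1' : Real.log q * (2 * Real.pi / Real.log q) = 2 * Real.pi := by field_simp
  have h1 : (Real.log q : ℂ) * ((2 * Real.pi / Real.log q : ℝ) : ℂ) = 2 * Real.pi := by
    rw [← ofReal_mul, h1']; push_cast; ring
  rw [cpow_def_of_ne_zero hq0, ← Complex.natCast_log]
  have : (Real.log q : ℂ) * -(((2 * Real.pi / Real.log q : ℝ) : ℂ) * I) = (-1 : ℤ) * (2 * Real.pi * I) := by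
    calc (Real.log q : ℂ) * -(((2 * Real.pi / Real.log q : ℝ) : ℂ) * I)
        = -((Real.log q : ℂ) * ((2 * Real.pi / Real.log q : ℝ) : ℂ)) * I := by ring
      _ = (-1 : ℤ) * (2 * Real.pi * I) := by rw [h1]; push_cast; ring
  rw [this, exp_int_mul_two_pi_mul_I]

/-- `q^{-(s + iτ)} = q^{-s}` for the period `τ = 2π / log q`. [folklore] -/
theorem natCast_cpow_neg_add_period {q : ℕ} (hq : 1 < q) (s : ℂ) :
    (q : ℂ) ^ (-(s + (2 * Real.pi / Real.log q : ℝ) * I)) = (q : ℂ) ^ (-s) := by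
  have hq0 : (q : ℂ) ≠ 0 := by exact_mod_cast (by omega : q ≠ 0)
  rw [neg_add, cpow_add _ _ hq0, natCast_cpow_neg_period hq, mul_one]

/-- Every function of `q^{-s}` — e.g. the zeta function `Z(X, q^{-s})` of a variety over `𝔽_q`,
or a Dirichlet polynomial in the powers of one prime — has a vertically periodic zero set, with
period `2π / log q`. [folklore] -/
theorem vertPeriodic_comp_cpow (P : ℂ → ℂ) {q : ℕ} (hq : 1 < q) :
    VertPeriodic (fun s => P ((q : ℂ) ^ (-s))) (2 * Real.pi / Real.log q) := by
  intro s hs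
  simpa only [natCast_cpow_neg_add_period hq] using hs

/-- [folklore] -/
theorem period_ne_zero {q : ℕ} (hq : 1 < q) : 2 * Real.pi / Real.log q ≠ 0 := by
  have : 0 < Real.log q := Real.log_pos (by exact_mod_cast hq)
  positivity

/-- FUNCTION-FIELD SHAPE: for `Z(s) = P(q^{-s})` rung #4 holds iff there is no off-line zero in the
open strip — over `𝔽_q` the band shape is the full RH-shape (Weil's theorem for curves), and a
"function-field sanity rung" cannot separate rung #4 from thesis X. [folklore] -/
theorem band_comp_cpow_iff (P : ℂ → ℂ) {q : ℕ} (hq : 1 < q) :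
    (∀ ε : ℝ, 0 < ε → (bandSet (fun s => P ((q : ℂ) ^ (-s))) ε).Finite) ↔
      offLineSet (fun s => P ((q : ℂ) ^ (-s))) = ∅ :=
  band_iff_offLineSet_eq_empty (period_ne_zero hq) (vertPeriodic_comp_cpow P hq)

/-! ## A single Euler factor `1 − α p^{−s}` -/

/-- An Euler factor is a function of `p^{-s}`, hence vertically periodic. [folklore] -/
theorem vertPeriodic_eulerTerm {p : ℕ} (hp : 1 < p) (α : ℂ) :
    VertPeriodic (eulerTerm p α) (2 * Real.pi / Real.log p) :=
  vertPeriodic_comp_cpow (fun x => 1 - α * x) hp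

/-- The zeros of `1 − α p^{−s}` fill ONE vertical line, `Re s = log ‖α‖ / log p`. [folklore] -/
theorem re_eq_of_eulerTerm_eq_zero {p : ℕ} (hp : 1 < p) {α s : ℂ} (h : eulerTerm p α s = 0) :
    s.re = Real.log ‖α‖ / Real.log p := by
  have hp0 : 0 < p := by omega
  have hlog : 0 < Real.log p := Real.log_pos (by exact_mod_cast hp)
  have hn := norm_eq_rpow_of_eulerTerm_eq_zero hp0 h
  rw [hn, Real.log_rpow (by exact_mod_cast hp0), mul_div_assoc, div_self hlog.ne', mul_one]

/-- Rung #4 for one Euler factor ⟺ no zero of the factor is off-line in the open strip. [folklore] -/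
theorem band_eulerTerm_iff {p : ℕ} (hp : 1 < p) (α : ℂ) :
    (∀ ε : ℝ, 0 < ε → (bandSet (eulerTerm p α) ε).Finite) ↔ offLineSet (eulerTerm p α) = ∅ :=
  band_iff_offLineSet_eq_empty (period_ne_zero hp) (vertPeriodic_eulerTerm hp α)

/-- If the line `Re s = log ‖α‖ / log p` lies in the open strip and off the critical line
(`1 < ‖α‖ < p`, `‖α‖ ≠ √p`), the factor `1 − α p^{−s}` carries a whole infinite band: the shape
FAILS (this generalises the non-tempered twist `1 − 2^{3/4−s}` of `not_band_zetaTwistedAtTwo`).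
[folklore] -/
theorem not_band_eulerTerm {p : ℕ} (hp : 1 < p) {α : ℂ} (h1 : 1 < ‖α‖) (h2 : ‖α‖ < p)
    (h3 : ‖α‖ ≠ Real.sqrt p) : ¬ ∀ ε : ℝ, 0 < ε → (bandSet (eulerTerm p α) ε).Finite := by
  rw [band_eulerTerm_iff hp]
  have hα : α ≠ 0 := fun h => by rw [h, norm_zero] at h1; linarith
  have hp0 : 0 < p := by omega
  have hp1 : (1 : ℝ) < p := by exact_mod_cast hp
  set s := eulerTermZero p α 0 with hs_def
  have hz : eulerTerm p α s = 0 := eulerTerm_eulerTermZero hp hα 0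
  have hn : ‖α‖ = (p : ℝ) ^ s.re := norm_eq_rpow_of_eulerTerm_eq_zero hp0 hz
  have h0 : 0 < s.re := by
    by_contra hle
    have : (p : ℝ) ^ s.re ≤ (p : ℝ) ^ (0 : ℝ) := Real.rpow_le_rpow_of_exponent_le hp1.le (not_lt.1 hle)
    rw [Real.rpow_zero, ← hn] at this
    linarith
  have h1' : s.re < 1 := by
    by_contra hle
    have : (p : ℝ) ^ (1 : ℝ) ≤ (p : ℝ) ^ s.re := Real.rpow_le_rpow_of_exponent_le hp1.le (not_lt.1 hle)
    rw [Real.rpow_one, ← hn] at this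
    linarith
  have hhalf : s.re ≠ 1 / 2 := by
    intro h
    rw [h, ← Real.sqrt_eq_rpow] at hn
    exact h3 hn
  intro he
  have : s ∈ offLineSet (eulerTerm p α) := ⟨hz, h0, h1', hhalf⟩
  rw [he] at this
  exact this

/-- If `‖α‖ = √p` every zero of `1 − α p^{−s}` lies ON the critical line: the shape holds (with
infinitely many critical zeros). [folklore] -/
theorem band_eulerTerm_of_norm_eq_sqrt {p : ℕ} (hp : 1 < p) {α : ℂ} (h : ‖α‖ = Real.sqrt p) :
    ∀ ε : ℝ, 0 < ε → (bandSet (eulerTerm p α) ε).Finite := by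
  rw [band_eulerTerm_iff hp]
  ext s
  simp only [offLineSet, mem_setOf_eq, mem_empty_iff_false, iff_false, not_and, not_not]
  intro hz _ _
  have hp0 : 0 < p := by omega
  have hp1 : (1 : ℝ) < p := by exact_mod_cast hp
  have hn : ‖α‖ = (p : ℝ) ^ s.re := norm_eq_rpow_of_eulerTerm_eq_zero hp0 hz
  rw [h, Real.sqrt_eq_rpow] at hn
  exact le_antisymm ((Real.rpow_le_rpow_left_iff hp1).1 hn.ge) ((Real.rpow_le_rpow_left_iff hp1).1 hn.le)

/-- If `‖α‖ ≤ 1` (e.g. the local factors `1 − p^{−s}` of `ζ`, or any factor with a unitary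
root) the factor has NO zero in the open strip: the shape holds vacuously. [folklore] -/
theorem bandSet_eulerTerm_eq_empty_of_norm_le_one {p : ℕ} (hp : 1 < p) {α : ℂ} (h : ‖α‖ ≤ 1)
    (ε : ℝ) : bandSet (eulerTerm p α) ε = ∅ := by
  ext s
  simp only [bandSet, mem_setOf_eq, mem_empty_iff_false, iff_false, not_and]
  intro hz h0 _ _
  have hp0 : 0 < p := by omega
  have hp1 : (1 : ℝ) < p := by exact_mod_cast hp
  have hn : ‖α‖ = (p : ℝ) ^ s.re := norm_eq_rpow_of_eulerTerm_eq_zero hp0 hz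
  have : (1 : ℝ) < (p : ℝ) ^ s.re := Real.one_lt_rpow hp1 h0
  linarith

/-! ## Finite Euler products -/

/-- The constant function `1` has empty bands. [folklore] -/
theorem bandSet_one (ε : ℝ) : bandSet (fun _ : ℂ => (1 : ℂ)) ε = ∅ := by
  ext s
  simp [bandSet]

/-- Off-line zeros of a product are the off-line zeros of the factors. [folklore] -/
theorem offLineSet_mul (Z W : ℂ → ℂ) :
    offLineSet (fun s => Z s * W s) = offLineSet Z ∪ offLineSet W := by
  ext s
  simp only [offLineSet, mem_setOf_eq, mem_union, mul_eq_zero]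
  tauto

/-- FINITE EULER PRODUCTS: `∏ᵢ (1 − αᵢ pᵢ^{−s})` has the band shape iff NO factor has an
off-line zero in the open strip — rung #4 ⟺ the exact RH-shape, factor by factor. The asymptotic
slack of rung #4 (off-line zeros with `Re ρ → 1/2`) needs the infinite product. [folklore] -/
theorem band_finiteEuler_iff {ι : Type*} (S : Finset ι) (p : ι → ℕ) (α : ι → ℂ)
    (hp : ∀ i ∈ S, 1 < p i) :
    (∀ ε : ℝ, 0 < ε → (bandSet (fun s => ∏ i ∈ S, eulerTerm (p i) (α i) s) ε).Finite) ↔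
      ∀ i ∈ S, offLineSet (eulerTerm (p i) (α i)) = ∅ := by
  classical
  induction S using Finset.induction_on with
  | empty =>
    simp only [Finset.prod_empty, Finset.notMem_empty, IsEmpty.forall_iff, implies_true, iff_true]
    intro ε _
    rw [bandSet_one]
    exact Set.finite_empty
  | insert a S ha ih =>
    have hfun : (fun s => ∏ i ∈ insert a S, eulerTerm (p i) (α i) s) =
        fun s => eulerTerm (p a) (α a) s * ∏ i ∈ S, eulerTerm (p i) (α i) s := by
      funext s
      exact Finset.prod_insert ha
    rw [hfun, band_mul_iff, ih fun i hi => hp i (Finset.mem_insert_of_mem hi),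
      band_eulerTerm_iff (hp a (Finset.mem_insert_self a S)), Finset.forall_mem_insert]

/-- … equivalently, iff the product itself has no off-line zero in the open strip. [folklore] -/
theorem band_finiteEuler_iff_offLineSet_eq_empty {ι : Type*} (S : Finset ι) (p : ι → ℕ)
    (α : ι → ℂ) (hp : ∀ i ∈ S, 1 < p i) :
    (∀ ε : ℝ, 0 < ε → (bandSet (fun s => ∏ i ∈ S, eulerTerm (p i) (α i) s) ε).Finite) ↔
      offLineSet (fun s => ∏ i ∈ S, eulerTerm (p i) (α i) s) = ∅ := by
  classical
  rw [band_finiteEuler_iff S p α hp]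
  have key : offLineSet (fun s => ∏ i ∈ S, eulerTerm (p i) (α i) s) =
      ⋃ i ∈ S, offLineSet (eulerTerm (p i) (α i)) := by
    ext s
    simp only [offLineSet, mem_setOf_eq, mem_iUnion, Finset.prod_eq_zero_iff, exists_prop]
    constructor
    · rintro ⟨⟨i, hi, hz⟩, h0, h1, hh⟩
      exact ⟨i, hi, hz, h0, h1, hh⟩
    · rintro ⟨i, hi, hz, h0, h1, hh⟩
      exact ⟨⟨i, hi, hz⟩, h0, h1, hh⟩
  rw [key]
  simp only [Set.iUnion_eq_empty]

/-- THE LOCAL FACTORS OF `ζ`: for every finite set of primes the finite Euler product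
`∏_{p ∈ S} (1 − p^{−s})` (the reciprocal of the `S`-local zeta function; all roots `α = 1`,
zeros on `Re s = 0`) has EMPTY bands — the `S`-local layer of a band statement has no zero
content; everything is in the limit `S → ∞`. [folklore] -/
theorem bandSet_zetaLocalFactors_eq_empty (S : Finset ℕ) (hS : ∀ p ∈ S, 1 < p) (ε : ℝ) :
    bandSet (fun s => ∏ p ∈ S, eulerTerm p 1 s) ε = ∅ := by
  classical
  induction S using Finset.induction_on with
  | empty => simpa using bandSet_one ε
  | insert a S ha ih =>
    have hfun : (fun s => ∏ p ∈ insert a S, eulerTerm p 1 s) =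
        fun s => eulerTerm a 1 s * ∏ p ∈ S, eulerTerm p 1 s := by
      funext s
      exact Finset.prod_insert ha
    rw [hfun, bandSet_mul, ih fun p hp => hS p (Finset.mem_insert_of_mem hp),
      bandSet_eulerTerm_eq_empty_of_norm_le_one (hS a (Finset.mem_insert_self a S)) (by simp),
      Set.empty_union]

/-- The `S`-LOCAL ZETA FUNCTION `ζ_S(s) = π^{−s/2} Γ(s/2) ∏_{p ∈ S} (1 − p^{−s})⁻¹` of a finite set
of places `S ∋ ∞` (the object of the route's foreseen first layer "S-local band realisation";
Connes 1999 Thm 4, Meyer 2005 p. 5). [folklore] -/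
def localZeta (S : Finset ℕ) (s : ℂ) : ℂ :=
  (Real.pi : ℂ) ^ (-s / 2) * Complex.Gamma (s / 2) * ∏ p ∈ S, (eulerTerm p 1 s)⁻¹

/-- `ζ_S` has NO zeros in the right half-plane `Re s > 0` (the archimedean factor never vanishes
there and the inverted Euler factors vanish — as Lean junk values of `⁻¹` — only on `Re s = 0`).
[folklore] -/
theorem localZeta_ne_zero (S : Finset ℕ) (hS : ∀ p ∈ S, 1 < p) {s : ℂ} (h0 : 0 < s.re) :
    localZeta S s ≠ 0 := by
  have hπ : (Real.pi : ℂ) ≠ 0 := ofReal_ne_zero.2 Real.pi_ne_zero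
  refine mul_ne_zero (mul_ne_zero ?_ ?_) ?_
  · rw [Ne, cpow_eq_zero_iff, not_and_or]
    exact Or.inl hπ
  · apply Complex.Gamma_ne_zero_of_re_pos
    rw [div_ofNat_re]
    positivity
  · rw [Finset.prod_ne_zero_iff]
    intro p hp
    rw [Ne, inv_eq_zero]
    intro hz
    have hp := hS p hp
    have hp0 : 0 < p := by omega
    have hp1 : (1 : ℝ) < p := by exact_mod_cast hp
    have hn : ‖(1 : ℂ)‖ = (p : ℝ) ^ s.re := norm_eq_rpow_of_eulerTerm_eq_zero hp0 hz
    rw [norm_one] at hn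
    have : (1 : ℝ) < (p : ℝ) ^ s.re := Real.one_lt_rpow hp1 h0
    linarith

/-- Hence EVERY band of `ζ_S` is EMPTY, for every finite `S`: the `S`-local layer of a band
statement has no zero content at all — the whole content of the crux is in the passage `S → ∞`
(uniformity of the constants), where vertical periodicity factor by factor is lost. [folklore] -/
theorem bandSet_localZeta_eq_empty (S : Finset ℕ) (hS : ∀ p ∈ S, 1 < p) (ε : ℝ) :
    bandSet (localZeta S) ε = ∅ := by
  ext s
  simp only [bandSet, mem_setOf_eq, mem_empty_iff_false, iff_false, not_and]
  intro hz h0 _ _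
  exact localZeta_ne_zero S hS h0 hz

end Summit.RiemannHypothesis.RiemannHypothesis.Theorems.AsymptoticCriticalLine.Negative
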